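import Summits.CriticalPhenomena.PercolationContinuityZ3.Theorems.PercNearOneGluingNoHeavyLowerTailSunflowerGraphCoreTriangle
import Summits.CriticalPhenomena.PercolationContinuityZ3.Theorems.PercNearOneGluingNoHeavyLowerTailSunflowerReadOnce
import HarnessLib

/-!
# `NoHeavyLowerTail` (crux stmt-CriticalPhenomena-4575), abstract sunflower cubic: COMPLETE BIPARTITE GRAPH CORES ARE A-SAFE

Support file (seat `prim-ineq-prove-1` gen 39; `--supports stmt-CriticalPhenomena-4575`).  No `sorry`, no named facts.  Memo:
run/shared/lean/prim/prim-ineq-prove-1/FINDING-GRAPHCORES-prove1-g39.md §3.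

A first positive infinite family for the typed conjecture `TriangleFreeSafe` ("triangle-free graphs have A-safe graph cores"): for disjoint
nonempty vertex sets `L, R` the graph core of the complete bipartite graph `K_{L,R}` (stars `K_{1,n}` included) is the disjoint-clause CNF
`(∨_{l∈L} x_l) ∧ (∨_{r∈R} x_r)` = `clauseCore {L, R}`, hence SAFE for every product measure by `safe_clauseCore` (g34/g36: disjoint-clause
CNFs are gradedly safe).  THEOREM `safe_edgeCore_completeBipartite`: `∀ p, Safe p (edgeCore (completeBipartite L R))`.
-/

noncomputable section

namespace Summit.CriticalPhenomena.PercolationContinuityZ3.Theorems.SunflowerPartition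

namespace SafeCalc

open MeasureTheory Finset
open Literature.Probability.LatticeModels Literature.Probability.Percolation

variable {ι : Type*} [DecidableEq ι]

/-- The complete bipartite graph between the vertex sets `L` and `R` (as `SimpleGraph.fromRel` of "`u ∈ L`, `v ∈ R`"). [this work] -/
def completeBipartite (L R : Finset ι) : SimpleGraph ι := SimpleGraph.fromRel fun u v => u ∈ L ∧ v ∈ R

/-- The graph core of `K_{L,R}` is the two-clause CNF "some vertex of `L` and some vertex of `R` are open". [this work] -/
theorem edgeCore_completeBipartite (L R : Finset ι) (hLR : Disjoint L R) :
    edgeCore (completeBipartite L R) = clauseCore ({L, R} : Finset (Finset ι)) := by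
  ext ω
  simp only [edgeCore, clauseCore, completeBipartite, SimpleGraph.fromRel_adj, Set.mem_setOf_eq, Finset.mem_insert,
    Finset.mem_singleton, forall_eq_or_imp, forall_eq]
  constructor
  · rintro ⟨u, v, ⟨-, (⟨hu, hv⟩ | ⟨hv, hu⟩)⟩, huω, hvω⟩
    · exact ⟨⟨u, hu, huω⟩, ⟨v, hv, hvω⟩⟩
    · exact ⟨⟨v, hv, hvω⟩, ⟨u, hu, huω⟩⟩
  · rintro ⟨⟨l, hl, hlω⟩, ⟨r, hr, hrω⟩⟩
    exact ⟨l, r, ⟨fun h => Finset.disjoint_left.1 hLR hl (h ▸ hr), Or.inl ⟨hl, hr⟩⟩, hlω, hrω⟩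

/-- **Complete bipartite graph cores (nonempty disjoint sides) are A-safe.** [this work] -/
theorem safe_edgeCore_completeBipartite [Fintype ι] (L R : Finset ι) (hLR : Disjoint L R) (hL : L.Nonempty) (hR : R.Nonempty)
    (p : ι → unitInterval) : Safe p (edgeCore (completeBipartite L R)) := by
  rw [edgeCore_completeBipartite L R hLR]
  refine safe_clauseCore p _ (fun C hC D hD hCD => ?_) (fun C hC => ?_)
  · simp only [Finset.mem_insert, Finset.mem_singleton] at hC hD
    rcases hC with rfl | rfl <;> rcases hD with rfl | rfl
    · exact absurd rfl hCD
    · exact hLR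
    · exact hLR.symm
    · exact absurd rfl hCD
  · simp only [Finset.mem_insert, Finset.mem_singleton] at hC
    rcases hC with rfl | rfl
    · exact hL
    · exact hR

/-- The complete bipartite graph is triangle-free (so `safe_edgeCore_completeBipartite` is an instance of `TriangleFreeSafe`). [this work] -/
theorem cliqueFree_three_completeBipartite (L R : Finset ι) (hLR : Disjoint L R) : (completeBipartite L R).CliqueFree 3 := by
  classical
  intro t ht
  rw [SimpleGraph.is3Clique_iff] at ht
  obtain ⟨a, b, c, hab, hac, hbc, -⟩ := ht
  simp only [completeBipartite, SimpleGraph.fromRel_adj] at hab hac hbc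
  have hdis : ∀ x, x ∈ L → x ∈ R → False := fun x hxL hxR => Finset.disjoint_left.1 hLR hxL hxR
  rcases hab.2 with ⟨haL, hbR⟩ | ⟨hbL, haR⟩ <;> rcases hac.2 with ⟨haL', hcR⟩ | ⟨hcL, haR'⟩ <;>
    rcases hbc.2 with ⟨hbL', hcR'⟩ | ⟨hcL', hbR'⟩
  all_goals first
    | exact hdis a haL haR'
    | exact hdis a haL' haR
    | exact hdis b hbL' hbR
    | exact hdis b hbL hbR'
    | exact hdis c hcL hcR'
    | exact hdis c hcL' hcR

end SafeCalc

end Summit.CriticalPhenomena.PercolationContinuityZ3.Theorems.SunflowerPartition
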